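import Summits.BirchSwinnertonDyer.BirchSwinnertonDyer.Theorems.KatoDescentTamePotSupersingularTameLowerFouquetRoadCitedSurj
import Literature.NumberTheory.EllipticCurves.Fouquet2025.OrdinaryCongruenceRankZeroBSDNakamura
import HarnessLib

/-!
# Route `KatoDescentTamePotSupersingular` (rung K8, sub-rung B4 (t′), cell `bsd-potss`): the Fouquet ordinary-seed road to
# L₀ (items 19981 / 19618), Σ = primes of `p·N_W·N_G`, over NAKAMURA's published zeta morphism — seed neither anomalous
# nor anti-anomalous, `p ∤ a_p(G)² − 1` — so that the chain has NO preprint input (a `--supports … --as helper` file;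
# seat bsd-potss-k8t-c2, generation 5)

The sibling roads run over the cite-level facts p446173 (strict Σ), p449673 (Σ = primes of `p N_W N_G`), which
transcribe Fouquet's Thm 4.1 under his printed Ass. 2.9/3.4. Fouquet's Thm 2.10 (the zeta morphism for `T_Σ`) is attributed to
«Nakamura, and independently Colmez–Wang»; the seat's D-AUDIT (§1d) records that Nakamura's PUBLISHED Thm 1.1 (Invent. Math.
234 (2023)) carries the local hypothesis (4) `ρ̄_p ≇ (1 ∗; 0 ε̄^{±1}) ⊗ χ`, one sign stronger than Ass. 2.9 (2) (= the
Colmez–Wang preprint's «générique»), and that for a good-ordinary seed `G` (`ρ̄_p ≅ (ωδ⁻¹ ∗; 0 δ)`, `δ(Frob_p) ≡ a_p(G)`) it fails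
iff `a_p(G)² ≡ 1 (mod p)`. The fact `Fouquet2025.padicValRat_bsd_rank_zero_of_ordinaryCongruence_nakamura` (p452337) adds the binder
`¬ p ∣ a_p(G)² − 1`; this file consumes it exactly as the Σ sibling (p449887), with the seed displayed by
`GoodOrd G p ∧ ¬ p ∣ a_p(G)² − 1 ∧ Surj G p ∧ Ram G p ∧ IsCongruentModP p W G ∧ FouquetEligibleAt p G`. Census (D-AUDIT rows
TSV): 203 of the 356 seeded rows of `L_{II*,5}` (38 of its 64 seeded content rows) have `a₅(G) ≡ ±2 (mod 5)`. Conditional on the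
cite-level fact + GZK + modularity; nothing credited; the items are NOT closed; BSD is not proved by any of this.

References: [Fouquet2025EquivariantTNC] Thm 4.1, Thm 1.7 (2), Ass. 3.4 (pp. 22–23); [SkinnerUrban2014] Thm 3.6.9 (p. 45);
[Nakamura2023ZetaMorphisms] Thm 1.1; [SerreAbelianLadic1968] Ch. IV §3.4 Lemma 3; [Miller2011LMS] Def. 1.1.
-/

set_option autoImplicit false
-- sibling precedent (`KatoDescentTamePotSupersingularAssembly.lean`): the directory name repeats the summit name
set_option linter.dupNamespace false

noncomputable section

open scoped Classical

namespace Summit.BirchSwinnertonDyer.BirchSwinnertonDyer.Theorems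

open WeierstrassCurve Literature.NumberTheory.EllipticCurves
  Literature.NumberTheory.EllipticCurves.ModularForms
  Literature.NumberTheory.EllipticCurves.Rank1Residual
  Literature.NumberTheory.EllipticCurves.Rank1Residual.Typed
  Summit.BirchSwinnertonDyer.Rank1Residual.Additive
  Summit.BirchSwinnertonDyer.Rank1Residual
  Summit.BirchSwinnertonDyer.BirchSwinnertonDyer.Theses.KatoDescentTamePotSupersingular

/-- **Bridge (definitional), Σ = primes(p N_W N_G), Nakamura form** (`p ∤ a_p(G)² − 1` displayed): on an additive row `W` at `p ≥ 5` with `ρ̄` onto,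
`FouquetGenericAt p W`, `FouquetEligibleAt p W`, and a congruent good-ordinary seed `G` with `ρ̄_{G,p}` onto, a ramified
multiplicative prime and `FouquetEligibleAt p G` (Ass. 3.4 at its unramified Steinberg primes), `L(W,1) ≠ 0` and `Ш(W)`
finite, the Σ-enlarged fact gives the print shape `PPartRankZero W p`. Conditional; nothing credited.
[cite: Fouquet2025EquivariantTNC, Thm 4.1 and Thm 1.7 (2)] [cite: SkinnerUrban2014, Thm 3.6.9 (p. 45)]
[cite: SerreAbelianLadic1968, Ch. IV §3.4 Lemma 3] -/
theorem pPartRankZero_of_fouquetOrdinaryCongruenceNakamura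
    (hF : Fouquet2025.padicValRat_bsd_rank_zero_of_ordinaryCongruence_nakamura)
    (W G : WeierstrassCurve ℚ) [W.IsElliptic] [W.IsGloballyMinimal] [G.IsElliptic] [G.IsGloballyMinimal]
    (p : ℕ) [Fact p.Prime] (hp : 5 ≤ p) (hadd : Addv W p) (hsurj : Surj W p) (hgen : FouquetGenericAt p W)
    (helig : FouquetEligibleAt p W) (hord : GoodOrd G p) (hnan : ¬ (p : ℤ) ∣ (G.frobeniusTrace p) ^ 2 - 1)
    (hsurjG : Surj G p) (hramG : Ram G p)
    (hcong : IsCongruentModP p W G) (heligG : FouquetEligibleAt p G) (hL : W.entireLFunction 1 ≠ 0)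
    (hfin : Finite W.sha) : PPartRankZero W p :=
  hF W G p hp hadd.1 hadd.2 hsurj hgen helig hord.1 hord.2 hnan
    (hasIrreducibleModPGaloisRep_of_hasSurjectiveModNGaloisRep G p hsurjG) hramG
    (serre_hasSurjectiveModNGaloisRep_pow_holds G p hp hsurjG) hcong heligG hL hfin

/-- **`MissingPPartAt W p` (both halves) on an additive rank-`0` row at `p ≥ 5` with a congruent good-ordinary seed,
Σ = primes(p N_W N_G), Nakamura form** — from the fact p452337 + modularity + GZK via `bsdp_of_pPartRankZero`. Conditional.
[cite: Fouquet2025EquivariantTNC, Thm 1.7 (2) (p. 7)] [cite: Miller2011LMS, Def. 1.1] -/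
theorem missingPPartAt_rankZero_of_fouquetOrdinaryCongruenceNakamura
    (hF : Fouquet2025.padicValRat_bsd_rank_zero_of_ordinaryCongruence_nakamura) (hmod : hasEntireLFunction_rat)
    (hGZK : rank_eq_analyticRank_of_analyticRank_le_one)
    (W G : WeierstrassCurve ℚ) [W.IsElliptic] [W.IsGloballyMinimal] [G.IsElliptic] [G.IsGloballyMinimal]
    (p : ℕ) [Fact p.Prime] (hp : 5 ≤ p) (hr : W.analyticRank = 0) (hadd : Addv W p) (hsurj : Surj W p)
    (hgen : FouquetGenericAt p W) (helig : FouquetEligibleAt p W) (hord : GoodOrd G p)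
    (hnan : ¬ (p : ℤ) ∣ (G.frobeniusTrace p) ^ 2 - 1) (hsurjG : Surj G p)
    (hramG : Ram G p) (hcong : IsCongruentModP p W G) (heligG : FouquetEligibleAt p G) : MissingPPartAt W p := by
  have hfin : Finite W.sha := (hGZK W (by omega)).2
  have hL : W.entireLFunction 1 ≠ 0 := by
    rw [← W.leadingLCoeff_eq_of_analyticRank_eq_zero hr]
    exact W.leadingLCoeff_ne_zero_holds (hmod W)
  exact missingPPartAt_of_bsdp W p
    (bsdp_of_pPartRankZero W p hmod hGZK hr
      (pPartRankZero_of_fouquetOrdinaryCongruenceNakamura hF W G p hp hadd hsurj hgen helig hord hnan hsurjG hramG hcong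
        heligG hL hfin))

/-- **L₀ on the (t′) Fouquet-seed rows, Nakamura form (no preprint input)** — class form with the seed displayed by
`GoodOrd ∧ p ∤ a_p(G)²−1 ∧ Surj ∧ Ram ∧ congruence ∧ FouquetEligibleAt p G`; hypotheses = the cite-level fact p452337 +
GZK + modularity. Conditional; nothing credited; the items are NOT closed.
[cite: Fouquet2025EquivariantTNC, Thm 4.1 and Thm 1.7 (2), Ass. 3.4 (pp. 22–23)] [cite: SkinnerUrban2014, Thm 3.6.9 (p. 45)]
[cite: Miller2011LMS, Def. 1.1] -/
theorem tameLowerHalf_fouquetSeedRows_of_nakamuraFact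
    (hF : Fouquet2025.padicValRat_bsd_rank_zero_of_ordinaryCongruence_nakamura)
    (hGZK : rank_eq_analyticRank_of_analyticRank_le_one) (hmod : hasEntireLFunction_rat) :
    ∀ (W : WeierstrassCurve ℚ) [W.IsElliptic] [W.IsGloballyMinimal] (p : ℕ) [Fact p.Prime],
      W.analyticRank = 0 → 5 ≤ p → Addv W p → SubTprime W p → Surj W p → FouquetGenericAt p W →
      FouquetEligibleAt p W →
      (∃ (G : WeierstrassCurve ℚ) (_ : G.IsElliptic) (_ : G.IsGloballyMinimal),
        GoodOrd G p ∧ ¬ (p : ℤ) ∣ (G.frobeniusTrace p) ^ 2 - 1 ∧ Surj G p ∧ Ram G p ∧ IsCongruentModP p W G ∧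
          FouquetEligibleAt p G) →
      MissingLowerBoundAt W p := by
  intro W _ _ p _ hr hp hadd _ hsurj hgen helig hseed
  obtain ⟨G, hGe, hGm, hord, hnan, hsurjG, hramG, hcong, heligG⟩ := hseed
  exact (lower_and_upper_of_missingPPartAt W p
    (missingPPartAt_rankZero_of_fouquetOrdinaryCongruenceNakamura hF hmod hGZK W G p hp hr hadd hsurj hgen helig hord hnan
      hsurjG hramG hcong heligG)).1

/-- **Both halves on the same rows, Nakamura form.** Conditional; nothing credited.
[cite: Fouquet2025EquivariantTNC, Thm 1.7 (2) (p. 7)] [cite: Miller2011LMS, Def. 1.1] -/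
theorem tameMissingPPartAt_fouquetSeedRows_of_nakamuraFact
    (hF : Fouquet2025.padicValRat_bsd_rank_zero_of_ordinaryCongruence_nakamura)
    (hGZK : rank_eq_analyticRank_of_analyticRank_le_one) (hmod : hasEntireLFunction_rat) :
    ∀ (W : WeierstrassCurve ℚ) [W.IsElliptic] [W.IsGloballyMinimal] (p : ℕ) [Fact p.Prime],
      W.analyticRank = 0 → 5 ≤ p → Addv W p → SubTprime W p → Surj W p → FouquetGenericAt p W →
      FouquetEligibleAt p W →
      (∃ (G : WeierstrassCurve ℚ) (_ : G.IsElliptic) (_ : G.IsGloballyMinimal),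
        GoodOrd G p ∧ ¬ (p : ℤ) ∣ (G.frobeniusTrace p) ^ 2 - 1 ∧ Surj G p ∧ Ram G p ∧ IsCongruentModP p W G ∧
          FouquetEligibleAt p G) →
      MissingPPartAt W p := by
  intro W _ _ p _ hr hp hadd _ hsurj hgen helig hseed
  obtain ⟨G, hGe, hGm, hord, hnan, hsurjG, hramG, hcong, heligG⟩ := hseed
  exact missingPPartAt_rankZero_of_fouquetOrdinaryCongruenceNakamura hF hmod hGZK W G p hp hr hadd hsurj hgen helig hord hnan
    hsurjG hramG hcong heligG

end Summit.BirchSwinnertonDyer.BirchSwinnertonDyer.Theorems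

end
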